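import Summits.HodgeConjecture.HodgeConjecture.Theorems.BlochSeedDiscThreeSchoenRigidity
import Literature.AlgebraicGeometry.HodgeTheory.FlatFamilyCycleClass
import Literature.AlgebraicGeometry.HodgeTheory.IsoTransport
import Literature.AlgebraicGeometry.HodgeTheory.GysinFormalismCorrespondences
import Summits.HodgeConjecture.HodgeConjecture.Theorems.HeckePrymWeilSemiregularSpreadOfBlochLifts
import Summits.HodgeConjecture.HodgeConjecture.Theorems.AnchorTransportVariationalHodgeQuasiProjective
import HarnessLib

/-!
# Crux `BlochSeedDiscThree` (`HasHyperbolicBlochSeed 4 3`) — helper 1/2: THE ENGINE (an étale-local flat lift spreads the class)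

§0 BEARS ON H2 — via the `d = 3` slice of Door A: `HasLocallyAlgebraicWeilAnchor 4 3`
(`Literature/AlgebraicGeometry/HodgeTheory/WeilClassesLocalAnchor.lean:155`) feeding the tree's
`WeilTypeLadder.weilSixfolds_slice_of_reach_of_localAnchor_four` (all `ℚ(√-3)`-Weil sixfolds), one arrow ABOVE the
seed crux `BlochSeedDiscThree := HasHyperbolicBlochSeed 4 3` of hsemireg's route «EightfoldBlochSeeds»
(`hasLocallyAlgebraicWeilAnchor_of_blochSpread_of_hyperbolicBlochSeed`). Companion of
`BlochSeedDiscThreeSchoenRigidity.lean` (plan g5; memo form `memos/ROUND-3-Rigidity.lean`, sha16 b3cbc3497475185a,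
farm rc 0): that file TYPES the rigidity theorem (R) = `SchoenRigidity` and proves the door theorems «(R) ⟹ no
Schoen cycle is a Bloch seed». THIS file (1/2) and `BlochSeedDiscThreeLiftableDoor.lean` (2/2) prove the CONVERSE
SIDE («Bloch asymmetry», memo ROUND-3-RIGIDITY §3 E-b / referee ask R3-1): if (R) FAILS on a hyperbolically polarised
frame, then the liftable Schoen cycle ALREADY delivers Door A's local input — no semiregularity, no D4 datum, no lci
question. The split 1/2 · 2/2 is by topic (gate rule: Theorems files ≤ 400 lines): here the ENGINE and its
bookkeeping; there DOOR L and THE SCHOEN DICHOTOMY, which consume the engine.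

## What is here (§G, first half — PROVED modulo ONE refereed named fact already in H2's trust base,
`fulton1998_flatFamily_cycleClass_specialises` — Fulton 1998 Prop. 10.1 (a), Cor. 10.1, Lemma 19.1.1, Cor. 19.2 (b);
the same fact the tree's `HeckePrymWeilLine.semiregularSpread_of_blochLifts_of_fulton` consumes)

* the predicates are `Literature.AlgebraicGeometry.HodgeTheory.{HasEtaleLocalFlatLift, IsWeilTypeFamily, ClassStaysHodge,
  WeilRigidObstructed, LiftsAlongWeilFamilies, …}` (`WeilClassesRigidObstruction.lean`).
* bookkeeping: `range_subset_closure_of_coheight_eq` (the image of an integral closed subscheme of codimension exactly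
  `p` is the closure of each of its codimension-`p` points), `classStaysHodge_of_globalClass` (Bloch's class
  hypothesis `ClassStaysHodge` WITNESSED by one global class), `liftsAlongWeilFamilies_iff_not_weilRigidObstructed`
  («`Z ⊂ P` lifts étale-locally along EVERY `√-d`-Weil family through `P` along which its class stays Hodge» is
  definitionally the pointwise negation of g5's `WeilRigidObstructed`).
* `spread_of_etaleLocalFlatLift_of_fulton` — THE ENGINE (Bloch 1972, second half of the proof of (7.4);
  Buchweitz–Flenner 2003 §5, end of the proof of Thm. 5.1/5.2): an ÉTALE-LOCAL FLAT LIFT of an integral closed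
  subscheme `Z₀ ⊂ X₀ = 𝒳_{s₀}` of codimension exactly `p` along a smooth projective family `f : 𝒳 ⟶ S` over a
  smooth base SPREADS every global class `W` whose restriction to `X₀` is supported on `Z₀`: `W|_{𝒳_t}` is
  algebraic for all `t` in an open neighbourhood of `s₀` in `S(ℂ)`. NO semiregularity, NO l.c.i. hypothesis, NO
  Hodge-type hypothesis (the lift encodes them). Proof = the tree's proof of `semiregularSpread_of_blochLifts_of_fulton`
  (route HeckePrymWeil) with Bloch's lift taken as the HYPOTHESIS instead of being produced from semiregularity:
  rigidity of flat sections if `W|_{X₀} = 0`; Fulton's class `Γ` of the flat family over the (smooth) étale base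
  change; purity on the irreducible codimension-`p` central fibre; rigidity of `c₀·pr^*W − λ·Γ` near `v₀`; descent
  along the open map `π` with lifting of complex points.

HONEST LABEL. (R) itself is NOT proved here or in 2/2 (gap (R¹) of memo §3 stands: `U = T₁₀`). Nothing here uses
`CM48Datum`'s content, `IsNormBuilt`, or `CMTypeIsPhi5`. Trust base: `fulton1998_flatFamily_cycleClass_specialises`
(named, refereed) + kernel. Farm check of record (memo form, frame inlined, both halves): rc 0, 0 sorries, 0 warnings;
axioms of `spread_of_etaleLocalFlatLift_of_fulton` = [propext, Classical.choice, Quot.sound].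

Provenance: cell `hodge-schoen` round 3 «(R) RIGIDITY» (director-hodge 2026-08-25T19:27:28Z); memos of record
`run/shared/lean/pub/hodge-schoen/memos/ROUND-3-RIGIDITY.md` (85fcfe7848962e66), `ROUND-3-Rigidity.lean` (b3cbc3497475185a, plan g5),
`ROUND-3-RigidityDichotomy.lean` (fd65c70677d60b95, plan g6), `ROUND-3-ADDENDUM-g6.md`; referee audit REFEREE-REPORT.md §J (r1–r5 PASS),
§K/§L; landing set `memos/landing-R3/LANDING.md` (split of the former single file T2, sha16 30161868c9faaedf, plan g8).
Supports item `stmt-HodgeConjecture-18882` (`EightfoldBlochSeeds.BlochSeedDiscThree := HasHyperbolicBlochSeed 4 3`).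

References: [Bloch1972Semiregularity] Thm. (7.1), proof of Thm. (7.4) pp. 64–65, Remark (7.5);
[BuchweitzFlenner2003] §5 (end of proof of Thm. 5.1/5.2); [Fulton1998] §10.1 Prop. 10.1 (a), Cor. 10.1, §19.1
Lemma 19.1.1, §19.2 Cor. 19.2 (b); [VoisinHodgeII2003] §3.1.2 (flat sections), §9.2; [Artin1969] Cor. (2.2).
-/

noncomputable section
set_option linter.dupNamespace false
open CategoryTheory CategoryTheory.Limits AlgebraicGeometry MonoidalCategory Polynomial
open Literature.AlgebraicGeometry Literature.AlgebraicGeometry.Motives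
open Literature.AlgebraicGeometry.Deformation
open Literature.AlgebraicGeometry.HodgeTheory
open Literature.AlgebraicTopology.SingularHomology
open Summit.HodgeConjecture.HodgeConjecture.Theorems (exists_isOpen_forall_map_fiberι_eq_zero
  map_fiberι_familyPullback_mem_algebraicClasses_iff exists_complexPoints_map_eq_of_pt_mem_image)

namespace Summit.HodgeConjecture.HodgeConjecture.Theorems.BlochSeedDiscThree

variable {𝒳 S : SchemeOver ℂ}

/-! ### Bookkeeping: generic points, Bloch's class hypothesis from a global class, the positive form -/

/-- **The image of an INTEGRAL closed subscheme of codimension exactly `p` is the closure of each of its points of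
codimension `p`** (such a point is the image of the generic point: a strict generisation inside the image would have
codimension `< p`). The step turning Bloch's class hypothesis at ONE point into `ClassStaysHodge` (the tree's
`HeckePrymWeilLine.semiregularSpread_of_blochLifts_of_fulton`, step `hgen`, same text).
[folklore: EGA IV₂ §5.1; Hartshorne II Ex. 3.20] -/
theorem range_subset_closure_of_coheight_eq {X Z₀ : Scheme.{0}} (i₀ : Z₀ ⟶ X) [IsClosedImmersion i₀]
    [AlgebraicGeometry.IsIntegral Z₀] {p : ℕ} (hcoh : ∀ z : Z₀, (p : ℕ∞) ≤ Order.coheight (i₀.base z))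
    (hcohp : ∃ z : Z₀, Order.coheight (i₀.base z) = (p : ℕ∞)) (z : Z₀)
    (hz : Order.coheight (i₀.base z) = (p : ℕ∞)) : Set.range i₀.base ⊆ closure {i₀.base z} := by
  haveI : IrreducibleSpace Z₀ := inferInstance
  set η : Z₀ := genericPoint Z₀ with hηdef
  have hη : Order.coheight (i₀.base η) = (p : ℕ∞) := by
    obtain ⟨z₁, hz₁⟩ := hcohp
    refine le_antisymm ?_ (hcoh η)
    rw [← hz₁]
    exact Order.coheight_anti (Scheme.le_iff_specializes.2
      ((genericPoint_specializes z₁).map i₀.continuous))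
  have hle : i₀.base z ≤ i₀.base η :=
    Scheme.le_iff_specializes.2 ((genericPoint_specializes z).map i₀.continuous)
  have hsp : i₀.base z ⤳ i₀.base η := by
    by_contra hne
    have hlt : i₀.base z < i₀.base η :=
      lt_of_le_not_ge hle (fun h => hne (Scheme.le_iff_specializes.1 h))
    have := Order.coheight_strictAnti hlt (by rw [hη]; exact ENat.coe_lt_top p)
    rw [hη, hz] at this
    exact lt_irrefl _ this
  have hcl : closure {i₀.base η} = Set.range i₀.base := by
    rw [← Set.image_singleton, i₀.isClosedEmbedding.closure_image_eq, hηdef,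
      genericPoint_closure, Set.image_univ]
  rw [← hcl]
  exact specializes_iff_closure_subset.1 hsp

/-- **Bloch's class hypothesis `ClassStaysHodge` WITNESSED BY ONE GLOBAL CLASS.** If a global class `B` on `𝒳` is of
Hodge type `(p,p)` on every fibre and its restriction to `X₀ = 𝒳_{s₀}` is NON-ZERO and supported on the image of the
integral codimension-`p` closed subscheme `Z₀`, then Bloch's hypothesis `SupportClassStaysHodge` holds at every
codimension-`p` point of `Z₀` (`SupportClassStaysHodge.intro` + `.mono` along `range_subset_closure_of_coheight_eq`).
[cite: Bloch1972Semiregularity, Thm. (7.4) (class hypothesis), Remark (7.5)] -/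
theorem classStaysHodge_of_globalClass (f : 𝒳 ⟶ S) (n p : ℕ) (s₀ : ComplexPoints S) {Z₀ : Scheme.{0}}
    (i₀ : Z₀ ⟶ (fiberOver f s₀).left) [IsClosedImmersion i₀] [AlgebraicGeometry.IsIntegral Z₀]
    (hcoh : ∀ z : Z₀, (p : ℕ∞) ≤ Order.coheight (i₀.base z))
    (hcohp : ∃ z : Z₀, Order.coheight (i₀.base z) = (p : ℕ∞)) (B : complexBetti 𝒳 (2 * p))
    (hB : ∀ s : ComplexPoints S,
      IsOfHodgeType n (fiberOver f s) (2 * p) p p (complexBetti.map (fiberι f s) (2 * p) B))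
    (hsupp : complexBetti.map (fiberι f s₀) (2 * p) B ∈
      classesSupportedOn (fiberOver f s₀) (Set.range i₀.base) (2 * p))
    (h0 : complexBetti.map (fiberι f s₀) (2 * p) B ≠ 0) : ClassStaysHodge f n p s₀ i₀ := fun z hz =>
  (SupportClassStaysHodge.intro B hB hsupp h0).mono (range_subset_closure_of_coheight_eq i₀ hcoh hcohp z hz)

/-- `LiftsAlongWeilFamilies` is the pointwise negation of `WeilRigidObstructed` (binder logic). [folklore] -/
theorem liftsAlongWeilFamilies_iff_not_weilRigidObstructed {n p d : ℕ} {P : AbelianVariety ℂ}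
    {Z₀ : Scheme.{0}} {i : Z₀ ⟶ P.X.left} :
    LiftsAlongWeilFamilies n p d P Z₀ i ↔ ¬ WeilRigidObstructed n p d P Z₀ i := by
  constructor
  · rintro h ⟨𝒳', S', f, s₀, e', hW, hC, hno⟩
    exact hno (h f s₀ e' hW hC)
  · intro h 𝒳' S' f s₀ e' hW hC
    by_contra hno
    exact h ⟨𝒳', S', f, s₀, e', hW, hC, hno⟩

/-! ### The engine: an étale-local flat lift spreads the class (Bloch (7.4), second half of the proof) -/

/-- **THE ENGINE — an étale-local flat lift SPREADS the supported class** (Bloch 1972, second half of the proof of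
(7.4); Buchweitz–Flenner 2003 §5, end of the proof of 5.1). Over a smooth projective family `f : 𝒳 ⟶ S` of relative
dimension `n` over a SMOOTH base, let `Z₀ ⊂ X₀ = 𝒳_{s₀}` be an INTEGRAL closed subscheme of codimension exactly `p`
admitting an ÉTALE-LOCAL FLAT LIFT (`HasEtaleLocalFlatLift`), and let `W` be a global class with `W|_{X₀}` supported
on `Z₀`. Then `W|_{𝒳_t}` is ALGEBRAIC for all `t` in an open neighbourhood of `s₀` in `S(ℂ)`. No semiregularity, no
l.c.i., no Hodge-type hypothesis. Proof: the tree's proof of `HeckePrymWeilLine.semiregularSpread_of_blochLifts_of_fulton`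
with the lift as HYPOTHESIS instead of Bloch's output — (0) `p = 0`: everything is algebraic; `W|_{X₀} = 0`: rigidity of
flat sections (`Theorems.exists_isOpen_forall_map_fiberι_eq_zero`); (1) base change to the étale `π : V → S` (smooth,
`V` smooth), Fulton's class `Γ` of the flat family (`hF`); (2) purity on the irreducible codimension-`p` central fibre
(`exists_ker_restrictCompl_le_span_of_isIrreducible`): `Γ|_{v₀} = c₀·w`, `θ^*W|_{X₀} = λ·w`, `λ ≠ 0`; (3) rigidity
of `c₀·pr^*W − λ·Γ` near `v₀`; (4) descent along the open map `π(ℂ)`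
(`Theorems.map_fiberι_familyPullback_mem_algebraicClasses_iff`, `Theorems.exists_complexPoints_map_eq_of_pt_mem_image`).
[cite: Bloch1972Semiregularity, proof of Thm. (7.4), pp. 64–65] [cite: BuchweitzFlenner2003, §5, end of proof of Thm. 5.1]
[cite: Fulton1998, Prop. 10.1 (a), Cor. 10.1, Lemma 19.1.1, Cor. 19.2 (b)] [cite: VoisinHodgeII2003, §3.1.2, §9.2] -/
theorem spread_of_etaleLocalFlatLift_of_fulton (hF : fulton1998_flatFamily_cycleClass_specialises)
    (f : 𝒳 ⟶ S) (n p : ℕ) (hf : IsSmoothProjectiveFamily f n) (hS : AlgebraicGeometry.Smooth S.hom)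
    (s₀ : ComplexPoints S) (Z₀ : Scheme.{0}) (i₀ : Z₀ ⟶ (fiberOver f s₀).left)
    (hi₀ : IsClosedImmersion i₀) (hint : AlgebraicGeometry.IsIntegral Z₀)
    (hcoh : ∀ z : Z₀, (p : ℕ∞) ≤ Order.coheight (i₀.base z))
    (hcohp : ∃ z : Z₀, Order.coheight (i₀.base z) = (p : ℕ∞))
    (hlift : HasEtaleLocalFlatLift f s₀ Z₀ i₀) (W : complexBetti 𝒳 (2 * p))
    (hsupp : complexBetti.map (fiberι f s₀) (2 * p) W ∈
      classesSupportedOn (fiberOver f s₀) (Set.range i₀.base) (2 * p)) :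
    ∃ U : Set (ComplexPoints S), IsOpen U ∧ s₀ ∈ U ∧
      ∀ t ∈ U, complexBetti.map (fiberι f t) (2 * p) W ∈ algebraicClasses (fiberOver f t) p := by
  haveI := hS
  haveI := hi₀
  haveI := hint
  -- (0a) codimension `0`: every class is algebraic
  rcases Nat.eq_zero_or_pos p with rfl | hp
  · exact ⟨Set.univ, isOpen_univ, Set.mem_univ _, fun t _ => by
      rw [algebraicClasses_zero]; trivial⟩
  -- (0b) `W|_{X₀} = 0`: rigidity of the flat section near `s₀`
  by_cases h0 : complexBetti.map (fiberι f s₀) (2 * p) W = 0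
  · obtain ⟨U, hU, hs₀U, hrig⟩ := exists_isOpen_forall_map_fiberι_eq_zero f hf s₀
    refine ⟨{t | t.pt ∈ U}, AlgPoints.isOpen_setOf_pt_mem (X := S) (L := ℂ) ⟨U, hU⟩, hs₀U,
      fun t ht => ?_⟩
    rw [hrig (2 * p) W h0 t ht]
    exact Submodule.zero_mem _
  -- the generic point `η` of the integral `Z₀` has codimension exactly `p` in `X₀`
  haveI : IrreducibleSpace Z₀ := inferInstance
  set η : Z₀ := genericPoint Z₀ with hηdef
  have hη : Order.coheight (i₀.base η) = (p : ℕ∞) := by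
    obtain ⟨z₁, hz₁⟩ := hcohp
    refine le_antisymm ?_ (hcoh η)
    rw [← hz₁]
    exact Order.coheight_anti (Scheme.le_iff_specializes.2
      ((genericPoint_specializes z₁).map i₀.continuous))
  -- (1) THE LIFT, now a HYPOTHESIS: an étale `π : V ⟶ S`, `v₀ ↦ s₀`, a `V`-flat closed `𝒵 ⊂ 𝒳_V` with
  -- `𝒵_{v₀} ≅ Z₀` over `𝒳_V → 𝒳`. From here on: the text of `semiregularSpread_of_blochLifts_of_fulton`.
  obtain ⟨V, π, hπ, v₀, hv₀, 𝒵, ι, hι, hflat, e, he⟩ := hlift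
  subst hv₀
  haveI := hπ
  haveI := hι
  haveI : AlgebraicGeometry.Smooth π.left := inferInstance
  haveI : AlgebraicGeometry.Smooth V.hom := by rw [← Over.w π]; infer_instance
  have hg : IsSmoothProjectiveFamily (familyPullback.snd f π) n := hf.familyPullback_snd π
  -- `θ : X₀' ≅ X₀`, the fibre of the base change over `v₀` and the fibre of `f` over `π v₀`
  set θ := fiberOverFamilyPullbackIso f π v₀ with hθdef
  have hhi : ∀ y, θ.hom.left.base (θ.inv.left.base y) = y := fun y => by
    rw [← Scheme.Hom.comp_apply, ← Over.comp_left, θ.inv_hom_id]; rfl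
  have hih : ∀ x, θ.inv.left.base (θ.hom.left.base x) = x := fun x => by
    rw [← Scheme.Hom.comp_apply, ← Over.comp_left, θ.hom_inv_id]; rfl
  -- the transported set `W₀' = θ⁻¹(Z₀)` on `X₀'`
  set W₀' : Set (fiberOver (familyPullback.snd f π) v₀).left := θ.hom.left.base ⁻¹' Set.range i₀.base
    with hW₀'
  have hW₀'c : IsClosed W₀' := i₀.isClosedEmbedding.isClosed_range.preimage θ.hom.left.continuous
  have hW₀'i : IsIrreducible W₀' := by
    have : W₀' = (fun w => θ.inv.left.base (i₀.base w)) '' Set.univ := by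
      ext x
      simp only [hW₀', Set.mem_preimage, Set.mem_range, Set.image_univ]
      constructor
      · rintro ⟨w, hw⟩
        exact ⟨w, by rw [hw, hih]⟩
      · rintro ⟨w, rfl⟩
        exact ⟨w, (hhi _).symm⟩
    rw [this]
    exact (IrreducibleSpace.isIrreducible_univ _).image _ (by fun_prop : Continuous _).continuousOn
  -- the central fibre of the flat family is `W₀'` (`∪ ∅`)
  have hsnd : pullback.snd ι (fiberι (familyPullback.snd f π) v₀).left ≫ θ.hom.left = e.hom ≫ i₀ := by
    haveI : Subsingleton ↥((specOver ℂ ℂ).left) := inferInstanceAs (Subsingleton (PrimeSpectrum ℂ))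
    haveI : IsClosedImmersion (AlgPoints.map π v₀).left :=
      isClosedImmersion_of_comp_eq_id _ _ (ComplexPoints.toSpecHom_comp_hom (AlgPoints.map π v₀))
    haveI : Mono (fiberι f (AlgPoints.map π v₀)).left := by
      change Mono (pullback.fst f.left (AlgPoints.map π v₀).left); infer_instance
    rw [← cancel_mono (fiberι f (AlgPoints.map π v₀)).left, Category.assoc, Category.assoc,
      ← Over.comp_left, hθdef, fiberOverFamilyPullbackIso_hom_fiberι, Over.comp_left,
      ← Category.assoc, ← pullback.condition, Category.assoc]
    exact he
  have hrange : Set.range (pullback.snd ι (fiberι (familyPullback.snd f π) v₀).left).base = W₀' ∪ ∅ := by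
    have key : ∀ z, θ.hom.left.base ((pullback.snd ι (fiberι (familyPullback.snd f π) v₀).left).base z) =
        i₀.base (e.hom.base z) := fun z => by
      rw [← Scheme.Hom.comp_apply, hsnd, Scheme.Hom.comp_apply]
    rw [Set.union_empty]
    ext x
    constructor
    · rintro ⟨z, rfl⟩
      exact ⟨e.hom.base z, (key z).symm⟩
    · rintro ⟨z₀, hz₀⟩
      obtain ⟨z, rfl⟩ := e.hom.surjective z₀
      exact ⟨z, by rw [← hih ((pullback.snd ι (fiberι (familyPullback.snd f π) v₀).left).base z),
          key, hz₀, hih]⟩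
  have hnot' : ¬ W₀' ⊆ ∅ := fun hsub => hsub (a := θ.inv.left.base (i₀.base η)) ⟨η, (hhi _).symm⟩
  have hcoh' : ∀ z ∈ W₀' ∪ ∅, (p : ℕ∞) ≤ Order.coheight z := by
    intro z hz
    rw [Set.union_empty] at hz
    obtain ⟨w, hw⟩ := hz
    rw [← coheight_left_base_eq_of_iso θ z, ← hw]
    exact hcoh w
  have hcoh2' : ∃ z ∈ W₀', Order.coheight z = (p : ℕ∞) :=
    ⟨θ.inv.left.base (i₀.base η), ⟨η, (hhi _).symm⟩, by
      rw [← hη, ← coheight_left_base_eq_of_iso θ, hhi]⟩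
  -- the flat-family cycle class (Fulton)
  obtain ⟨Γ, w, c₀, hΓ, hw, hw0, hc0, hΓw⟩ := hF (p := p) (familyPullback.snd f π) hg ‹_› 𝒵 ι hι
    hflat v₀ W₀' ∅ hW₀'c hW₀'i isClosed_empty hrange hnot' hcoh' hcoh2'
  -- no non-zero class is supported on `∅`: `Γ|_{X₀'} = c₀ • w`
  have hΓv₀ : complexBetti.map (fiberι (familyPullback.snd f π) v₀) (2 * p) Γ = c₀ • w := by
    rw [classesSupportedOn_empty, Submodule.mem_bot] at hΓw
    exact sub_eq_zero.1 hΓw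
  -- purity: the classes supported on `W₀'` form a line, so `θ^* (W|_{X₀}) = λ • w`, `λ ≠ 0`
  obtain ⟨τ, hτ⟩ := exists_ker_restrictCompl_le_span_of_isIrreducible (hg.isSmoothProjective v₀)
    hW₀'c hW₀'i (c := p) hp fun z hz => hcoh' z (Or.inl hz)
  set x₀ := complexBetti.map (fiberι f (AlgPoints.map π v₀)) (2 * p) W with hx₀def
  have hx₀' : complexBetti.map θ.hom (2 * p) x₀ ∈ classesSupportedOn _ W₀' (2 * p) :=
    mem_classesSupportedOn_iff.2
      (complexBetti.restrictCompl_map_eq_zero θ.hom (mem_classesSupportedOn_iff.1 hsupp))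
  obtain ⟨lam, hlam⟩ : ∃ lam : ℂ, complexBetti.map θ.hom (2 * p) x₀ = lam • w := by
    obtain ⟨a, ha⟩ := Submodule.mem_span_singleton.1 (hτ hw)
    obtain ⟨b, hb⟩ := Submodule.mem_span_singleton.1 (hτ hx₀')
    have ha0 : a ≠ 0 := by
      rintro rfl
      exact hw0 (by rw [← ha, zero_smul])
    exact ⟨b / a, by rw [← hb, ← ha, smul_smul, div_mul_cancel₀ b ha0]⟩
  have hlam0 : lam ≠ 0 := by
    rintro rfl
    rw [zero_smul] at hlam
    exact h0 ((complexBetti.bijective_map_of_iso θ (2 * p)).1 (by rw [hlam, map_zero]))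
  -- the global class `Θ := c₀ • pr^* W - λ • Γ` on `𝒳 ×_S V` vanishes on `X₀'`
  set Θ : complexBetti (familyPullback f π) (2 * p) :=
    c₀ • complexBetti.map (familyPullback.fst f π) (2 * p) W - lam • Γ with hΘ
  have hΘ0 : complexBetti.map (fiberι (familyPullback.snd f π) v₀) (2 * p) Θ = 0 := by
    rw [hΘ, map_sub, map_smul, map_smul, map_fiberι_familyPullback, ← hθdef, ← hx₀def, hlam, hΓv₀,
      smul_comm, sub_self]
  -- rigidity over a Zariski neighbourhood `U` of `v₀`: there `pr^* W|_{X_{t'}} = (λ/c₀) • Γ|_{X_{t'}}`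
  obtain ⟨U, hU, hv₀U, hrig⟩ := exists_isOpen_forall_map_fiberι_eq_zero (familyPullback.snd f π) hg v₀
  have halg : ∀ t' : ComplexPoints V, t'.pt ∈ U →
      complexBetti.map (fiberι f (AlgPoints.map π t')) (2 * p) W ∈
        algebraicClasses (fiberOver f (AlgPoints.map π t')) p := by
    intro t' ht'
    rw [← map_fiberι_familyPullback_mem_algebraicClasses_iff f π hf W t']
    have hM := hrig (2 * p) Θ hΘ0 t' ht'
    rw [hΘ, map_sub, map_smul, map_smul, sub_eq_zero] at hM
    have hM' : complexBetti.map (fiberι (familyPullback.snd f π) t') (2 * p)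
        (complexBetti.map (familyPullback.fst f π) (2 * p) W) =
        c₀⁻¹ • (lam • complexBetti.map (fiberι (familyPullback.snd f π) t') (2 * p) Γ) := by
      rw [← hM, smul_smul, inv_mul_cancel₀ hc0, one_smul]
    rw [hM']
    exact Submodule.smul_mem _ _ (Submodule.smul_mem _ _ (hΓ t'))
  -- the image `π(U)` is a Zariski neighbourhood of `pt s₀`, and complex points over it lift to `U`
  haveI : LocallyOfFiniteType S.hom := inferInstance
  haveI : LocallyOfFiniteType π.left := inferInstance
  have hπU : IsOpen ((π.left : V.left → S.left) '' U) := π.left.isOpenMap U hU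
  refine ⟨{t | t.pt ∈ (π.left : V.left → S.left) '' U},
    AlgPoints.isOpen_setOf_pt_mem (X := S) (L := ℂ) ⟨_, hπU⟩, ⟨v₀.pt, hv₀U, rfl⟩, fun t ht => ?_⟩
  obtain ⟨t', ht'U, rfl⟩ := exists_complexPoints_map_eq_of_pt_mem_image π hU t ht
  exact halg t' ht'U

end Summit.HodgeConjecture.HodgeConjecture.Theorems.BlochSeedDiscThree

end
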